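import Summits.HodgeConjecture.HodgeConjecture.Theorems.F0P3cStCharTSWeylHypMeasure     -- ★ p849733 (LH2-p02 (g3)): `exists_conjFamily`, §2 radial-`∫⁻`-to-Bochner transport (`map_prod_eq_smul_restrict_of_lintegral_radial`, `integrable_and_integral_eq_smul_of_lintegral_radial`)
import Literature.MeasureTheory.Group.ConjugationWeylVanishing                            -- ★ THE ENGINE: `exists_radialMeasure_lintegral_conjFamily`, `polishSpace_quotient_prod_subgroup`
import Literature.NumberTheory.Rogawski1990.LocalTransfer                                 -- ★ `IsLocalGRegular` (the road's `R_H`), the `H_v` carriers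
import Summits.HodgeConjecture.HodgeConjecture.Theorems.F0P3cStCharTSUpTrWeylFinH      -- ★ p852373 (H3a) WEYL-FIN-H (F0P3a-p01 (g22)): `index_centralizer_subgroupOf_normalizer_ne_zero` (`[N_H(Z_H(γ₀)) : Z_H(γ₀)] ≠ 0`)
import Summits.HodgeConjecture.HodgeConjecture.Theorems.F0P3cStCharTSUpTrCartanFields   -- ★ p852366 (H3b) CARTAN-FIELDS-H (LH4-p01 (g8)): `isClosed_cartan`, `centralizer_eq_cartan_of_isLocalGRegular`, `measurableSet_setOf_isLocalGRegular`
import Literature.NumberTheory.Automorphic.LocalOrbitalMeasureRegular                      -- ★ `centralizer_comm_of_isLocalGRegular` (`Z_H(γ₀)` abelian for `G`-regular `γ₀`)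
import Literature.NumberTheory.Rogawski1990.UnitFundamentalLemmaInertLeviClause           -- ★ `isLocalGRegular_conj_iff` (`G`-regularity is conjugation-invariant in `H_v`)
import HarnessLib

/-!
# F0 · P3c · crux H413 — ROAD «UP-TR», brick (H3c) «RADIAL-H»: the radial Weyl integration formula on the `T`-regular set of a Cartan subgroup `T = Z_H(γ₀)` of
# `H_v = U(Φ₂)(L⁺_v) × U(Φ₁)(L⁺_v)` (`γ₀` `G`-regular), by shape over the generic engine [HarishChandra1970 Lemma 42; Weil 1965 n° 49; Rogawski 1990 §12.5 pp. 182–183]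

Cell `pub/hodgecm-mathlib`, crux H413 = `stmt-HodgeConjecture-24833` (lane `--supports`, helper, count-neutral), route HCCMUnconditional; seat F0P3a-p06 (g22); ROAD «UP-TR»
(holder ∕ dealer F0P3-p02 (g23), board `F0/P3/F0P3-p02/g23/ROAD-UP-TR.v1.F0P3p02g23.md`, LEAD T14-21), brick (H3c) = the `H_v`-TWIN of ★ (E0) «ELL-TOR★»
`F0P3cStCharTSWeylCartanRadial` (F0P3a-p05 (g22)).  THEOREMS ONLY (no definition ∕ instance ∕ notation ∕ named fact ∕ `sorry`); ★-only imports; axioms TRIO.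

THE POINT.  The `H_v`-side of [Rogawski1990, Lemma 12.5.1] (the adjoint `α ↦ α^G` of the endoscopic transfer is a distribution given by a class function) is a Weyl
integration formula on `H_v` in which «regular» means `G`-REGULAR (the road's letter `R_H := IsLocalGRegular L v`: the block image `ι_v(γ_H) ∈ U(Φ₃)(L⁺_v)` is regular
semisimple).  This file instantiates the ★ GENERIC engine `Literature.MeasureTheory.Group.exists_radialMeasure_lintegral_conjFamily` at
`(G, T, R) := (H_v, Z_H(γ₀), {s | IsLocalGRegular L v s})` for ANY `G`-regular `γ₀ ∈ H_v`, exactly as ★ (E0) does at `U(Φ₃)(L⁺_v)`: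

  **`[N_H(T) : T] · ∫⁻_{H_T} f dν = ∫⁻_T ∫⁻_{H_v ⧸ T} f(Φ(q, s)) d(ν∕tm)(q) dσ_T(s)`**   (every Borel `f ≥ 0`),  `H_T := {h s h⁻¹ | s ∈ T  G-regular}`,

for a measure `σ_T` on `T`, finite on compact sets, σ-finite and CARRIED BY `T^{G-reg}` (`exists_radialMeasure_lintegral_cartanSetH`), with the measure form and the ℂ-valued
BOCHNER form `∫_T ∫_{H_v⧸T} g(Φ(q,s)) = [N_H(T):T] • ∫_{H_T} g dν` (`exists_radialMeasure_integral_cartanSetH`, ★ p849733 §2 transport verbatim), and `H_T` Borel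
(`measurableSet_cartanSetH`, Lusin–Souslin through ★ `exists_isOpen_injOn_conjFamily`).  Classically `dσ_T = D_H-type Jacobian · dtm` — NOT asserted here: that is the socket
of (H4s)∕(H4c) «JAC-H» (tube Jacobians with weight `dh²`), signed by the JAC lineages first (T14-21 (2)).

BY SHAPE in §1–§2 (road rule: (H3a)(H3b) are separate bricks; the engine's hypotheses token for token), BY NAME in §3 at `T = Z_H(γ₀)` (EVERY binder discharged:
★ (H3a) p852373, ★ (H3b) p852366, ★ `centralizer_comm_of_isLocalGRegular`, ★ `isLocalGRegular_conj_iff`) — the §3 head is UNCONDITIONAL: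
* (H3b) CARTAN-FIELDS-H: `hTa : ∀ a ∈ T, ∀ b ∈ T, a * b = b * a` (`Z_H(γ₀)` abelian), `hRT : ∀ s : ↥T, IsLocalGRegular L v ↑s → Z_H(↑s) = T`, `hRc : ∀ g x, IsLocalGRegular L v x →
  IsLocalGRegular L v (g x g⁻¹)`, `hRm : MeasurableSet {s | IsLocalGRegular L v s}`;
* (H3a) WEYL-FIN-H: `hW : (T.subgroupOf (Subgroup.normalizer ↑T)).index ≠ 0`.
`hTc : IsClosed ↑T` (for `T = Z_H(γ₀)`: Mathlib `Set.isClosed_centralizer`, or (H3b)'s export), the conjugation family `Φ(xT, s) = x s x⁻¹` is ★ `exists_conjFamily` at the caller.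

CARRIER.  `H_v = (cmDatum L 2 Φ₂).Local v × (cmDatum L 1 Φ₁).Local v` (the organ's product type), `T : Subgroup H_v` (meant: `T = Z_H(γ₀)`, `γ₀` `G`-regular — every property of `T` the engine reads is a BY-SHAPE binder, so no `γ₀` appears); the topological ∕
measurable structures on `H_v` and on `H_v ⧸ T` are instance ARGUMENTS (as ★ (E0): Borel structure ON THE PRODUCT as RUNG0's `νHv` binder has it; `LocallyCompactSpace` ∕
`SecondCountableTopology` ∕ `T2Space` of the product from the caller's ★ `locallyCompactSpace_local` ∕ `secondCountableTopology_local` ∕ `t2Space_cmDatum_local` terms); the Haar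
data `ν` on `H_v` (`[IsHaarMeasure] [IsMulRightInvariant]`) and `tm` on `T` are parameters with ★ `quotientMeasure`'s standing instance hypotheses.

HONEST LABEL: count-neutral; block consequents 11 → 10 → 9 only at the rider editions; organs 2 = 2; h413 registry untouched; HC_CM is proved only modulo the printed citations
until rung 0 closes.

## References
* [Rogawski1990] J. D. Rogawski, *Automorphic Representations of Unitary Groups in Three Variables*, Ann. of Math. Stud. 123 (1990), §4.3 p. 42 (`G`-regular), §12.5 pp. 182–183
  (Weyl integration on `H`, Lemma 12.5.1).
* [HarishChandra1970] Harish-Chandra, *Harmonic analysis on reductive p-adic groups*, LNM 162 (1970), Lemma 42 (and Lemma 22 for the Jacobian).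
* [Weil1965] A. Weil, *Sur la formule de Siegel dans la théorie des groupes classiques*, Acta Math. 113 (1965), n° 49 Lemme 22 (p. 70).
* [Federer1969] H. Federer, *Geometric Measure Theory* (1969), §2.10.10.
-/

set_option autoImplicit false
-- the mandated namespace has the single-problem summit's repeated segment (`HodgeConjecture.HodgeConjecture`)
set_option linter.dupNamespace false

noncomputable section

open MeasureTheory Measure Set Filter Topology Function NumberField IsDedekindDomain
open Literature.MeasureTheory.Group
open Literature.NumberTheory.Automorphic Literature.NumberTheory.Automorphic.UnitaryGroup Literature.NumberTheory.Rogawski1990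
open Summit.HodgeConjecture.HodgeConjecture.Cruxes.H413.F0P3cStCharTSWeylHypMeasure
open scoped ENNReal NNReal MatrixGroups Pointwise

namespace Summit.HodgeConjecture.HodgeConjecture.Cruxes.H413.F0P3cStCharTSUpTrRadial

variable {L : Type} [Field L] [NumberField L] [IsCMField L] {v : HeightOneSpectrum (𝓞 ↥(maximalRealSubfield L))}

/-! ## §1 The `T`-regular set `H_T = ⋃ₓ x T^{G-reg} x⁻¹` of a (Cartan) subgroup `T` of `H_v` -/

section Cartan

variable
  {T : Subgroup ((cmDatum L 2 (Matrix.of fun i j : Fin 2 => if i.val + j.val + 1 = 2 then (1 : L) else 0)).Local v ×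
      (cmDatum L 1 (Matrix.of fun i j : Fin 1 => if i.val + j.val + 1 = 1 then (1 : L) else 0)).Local v)}

variable
  (Φ : (((cmDatum L 2 (Matrix.of fun i j : Fin 2 => if i.val + j.val + 1 = 2 then (1 : L) else 0)).Local v ×
      (cmDatum L 1 (Matrix.of fun i j : Fin 1 => if i.val + j.val + 1 = 1 then (1 : L) else 0)).Local v) ⧸ T) × ↥T →
    ((cmDatum L 2 (Matrix.of fun i j : Fin 2 => if i.val + j.val + 1 = 2 then (1 : L) else 0)).Local v ×
      (cmDatum L 1 (Matrix.of fun i j : Fin 1 => if i.val + j.val + 1 = 1 then (1 : L) else 0)).Local v))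
  (hΦ : ∀ (x : (cmDatum L 2 (Matrix.of fun i j : Fin 2 => if i.val + j.val + 1 = 2 then (1 : L) else 0)).Local v ×
      (cmDatum L 1 (Matrix.of fun i j : Fin 1 => if i.val + j.val + 1 = 1 then (1 : L) else 0)).Local v) (t : ↥T),
    Φ (QuotientGroup.mk x, t) = x * t * x⁻¹)

include hΦ in
/-- **The `T`-regular set `H_T` is the image of the `G`-regular part of `H_v ⧸ T × T` under `Φ`**: `Φ '' {p | ↑p.2 G-regular} = {x | ∃ g, ∃ s ∈ T, s G-regular ∧ g s g⁻¹ = x}`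
(the engine's membership spelling `↑p.2 ∈ {s | IsLocalGRegular L v s}` on the left). [cite: HarishChandra1970, Lemma 42] -/
theorem image_conjFamily_GRegular_eq :
    Φ '' {p | ((p.2 : ↥T) : (cmDatum L 2 (Matrix.of fun i j : Fin 2 => if i.val + j.val + 1 = 2 then (1 : L) else 0)).Local v ×
        (cmDatum L 1 (Matrix.of fun i j : Fin 1 => if i.val + j.val + 1 = 1 then (1 : L) else 0)).Local v) ∈
          {s : (cmDatum L 2 (Matrix.of fun i j : Fin 2 => if i.val + j.val + 1 = 2 then (1 : L) else 0)).Local v ×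
            (cmDatum L 1 (Matrix.of fun i j : Fin 1 => if i.val + j.val + 1 = 1 then (1 : L) else 0)).Local v | IsLocalGRegular L v s}} =
      {x | ∃ g t : (cmDatum L 2 (Matrix.of fun i j : Fin 2 => if i.val + j.val + 1 = 2 then (1 : L) else 0)).Local v ×
          (cmDatum L 1 (Matrix.of fun i j : Fin 1 => if i.val + j.val + 1 = 1 then (1 : L) else 0)).Local v,
        t ∈ T ∧ IsLocalGRegular L v t ∧ g * t * g⁻¹ = x} := by
  ext x
  constructor
  · rintro ⟨⟨q, t⟩, ht, rfl⟩
    obtain ⟨g, rfl⟩ := QuotientGroup.mk_surjective q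
    exact ⟨g, t, t.2, ht, (hΦ g t).symm⟩
  · rintro ⟨g, t, htT, ht, rfl⟩
    exact ⟨(QuotientGroup.mk g, ⟨t, htT⟩), ht, hΦ g ⟨t, htT⟩⟩

variable
  (hTc : IsClosed (T : Set ((cmDatum L 2 (Matrix.of fun i j : Fin 2 => if i.val + j.val + 1 = 2 then (1 : L) else 0)).Local v ×
      (cmDatum L 1 (Matrix.of fun i j : Fin 1 => if i.val + j.val + 1 = 1 then (1 : L) else 0)).Local v)))
  (hTa : ∀ a ∈ T, ∀ b ∈ T, a * b = b * a)
  (hRT : ∀ s : ↥T, IsLocalGRegular L v (s : (cmDatum L 2 (Matrix.of fun i j : Fin 2 => if i.val + j.val + 1 = 2 then (1 : L) else 0)).Local v ×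
      (cmDatum L 1 (Matrix.of fun i j : Fin 1 => if i.val + j.val + 1 = 1 then (1 : L) else 0)).Local v) →
    Subgroup.centralizer ({(s : (cmDatum L 2 (Matrix.of fun i j : Fin 2 => if i.val + j.val + 1 = 2 then (1 : L) else 0)).Local v ×
      (cmDatum L 1 (Matrix.of fun i j : Fin 1 => if i.val + j.val + 1 = 1 then (1 : L) else 0)).Local v)} :
        Set ((cmDatum L 2 (Matrix.of fun i j : Fin 2 => if i.val + j.val + 1 = 2 then (1 : L) else 0)).Local v ×
          (cmDatum L 1 (Matrix.of fun i j : Fin 1 => if i.val + j.val + 1 = 1 then (1 : L) else 0)).Local v)) = T)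
  (hRc : ∀ g x : (cmDatum L 2 (Matrix.of fun i j : Fin 2 => if i.val + j.val + 1 = 2 then (1 : L) else 0)).Local v ×
      (cmDatum L 1 (Matrix.of fun i j : Fin 1 => if i.val + j.val + 1 = 1 then (1 : L) else 0)).Local v,
    IsLocalGRegular L v x → IsLocalGRegular L v (g * x * g⁻¹))
  (hW : (T.subgroupOf (Subgroup.normalizer (T : Set ((cmDatum L 2 (Matrix.of fun i j : Fin 2 => if i.val + j.val + 1 = 2 then (1 : L) else 0)).Local v ×
      (cmDatum L 1 (Matrix.of fun i j : Fin 1 => if i.val + j.val + 1 = 1 then (1 : L) else 0)).Local v)))).index ≠ 0)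
  [MeasurableSpace ((cmDatum L 2 (Matrix.of fun i j : Fin 2 => if i.val + j.val + 1 = 2 then (1 : L) else 0)).Local v ×
      (cmDatum L 1 (Matrix.of fun i j : Fin 1 => if i.val + j.val + 1 = 1 then (1 : L) else 0)).Local v)]
  [BorelSpace ((cmDatum L 2 (Matrix.of fun i j : Fin 2 => if i.val + j.val + 1 = 2 then (1 : L) else 0)).Local v ×
      (cmDatum L 1 (Matrix.of fun i j : Fin 1 => if i.val + j.val + 1 = 1 then (1 : L) else 0)).Local v)]
  [LocallyCompactSpace ((cmDatum L 2 (Matrix.of fun i j : Fin 2 => if i.val + j.val + 1 = 2 then (1 : L) else 0)).Local v ×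
      (cmDatum L 1 (Matrix.of fun i j : Fin 1 => if i.val + j.val + 1 = 1 then (1 : L) else 0)).Local v)]
  [SecondCountableTopology ((cmDatum L 2 (Matrix.of fun i j : Fin 2 => if i.val + j.val + 1 = 2 then (1 : L) else 0)).Local v ×
      (cmDatum L 1 (Matrix.of fun i j : Fin 1 => if i.val + j.val + 1 = 1 then (1 : L) else 0)).Local v)]
  [T2Space ((cmDatum L 2 (Matrix.of fun i j : Fin 2 => if i.val + j.val + 1 = 2 then (1 : L) else 0)).Local v ×
      (cmDatum L 1 (Matrix.of fun i j : Fin 1 => if i.val + j.val + 1 = 1 then (1 : L) else 0)).Local v)]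
  [MeasurableSpace (((cmDatum L 2 (Matrix.of fun i j : Fin 2 => if i.val + j.val + 1 = 2 then (1 : L) else 0)).Local v ×
      (cmDatum L 1 (Matrix.of fun i j : Fin 1 => if i.val + j.val + 1 = 1 then (1 : L) else 0)).Local v) ⧸ T)]
  [BorelSpace (((cmDatum L 2 (Matrix.of fun i j : Fin 2 => if i.val + j.val + 1 = 2 then (1 : L) else 0)).Local v ×
      (cmDatum L 1 (Matrix.of fun i j : Fin 1 => if i.val + j.val + 1 = 1 then (1 : L) else 0)).Local v) ⧸ T)]
  (hRm : MeasurableSet {s : (cmDatum L 2 (Matrix.of fun i j : Fin 2 => if i.val + j.val + 1 = 2 then (1 : L) else 0)).Local v ×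
      (cmDatum L 1 (Matrix.of fun i j : Fin 1 => if i.val + j.val + 1 = 1 then (1 : L) else 0)).Local v | IsLocalGRegular L v s})

include hTc hΦ hTa hRT hW hRm in
/-- **The `T`-regular set `H_T = ⋃ₓ x T^{G-reg} x⁻¹` is BOREL** (Lusin–Souslin: `Φ` is continuous and locally injective on the Borel `G`-regular part of the Polish space
`H_v ⧸ T × T`, ★ `exists_isOpen_injOn_conjFamily` + ★ `measurableSet_image_inter_of_locallyInjOn`); (H3a)(H3b) by shape. [cite: Federer1969, §2.10.10]
[cite: HarishChandra1970, Lemma 42] -/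
theorem measurableSet_cartanSetH :
    MeasurableSet {x | ∃ g t : (cmDatum L 2 (Matrix.of fun i j : Fin 2 => if i.val + j.val + 1 = 2 then (1 : L) else 0)).Local v ×
          (cmDatum L 1 (Matrix.of fun i j : Fin 1 => if i.val + j.val + 1 = 1 then (1 : L) else 0)).Local v,
        t ∈ T ∧ IsLocalGRegular L v t ∧ g * t * g⁻¹ = x} := by
  classical
  haveI : PolishSpace ((((cmDatum L 2 (Matrix.of fun i j : Fin 2 => if i.val + j.val + 1 = 2 then (1 : L) else 0)).Local v ×
      (cmDatum L 1 (Matrix.of fun i j : Fin 1 => if i.val + j.val + 1 = 1 then (1 : L) else 0)).Local v) ⧸ T) × ↥T) :=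
    polishSpace_quotient_prod_subgroup T hTc
  have hΦc : Continuous Φ := (continuous_conjFamily_and_smul T Φ hΦ).1
  haveI : SecondCountableTopology ↥T := TopologicalSpace.Subtype.secondCountableTopology _
  haveI : BorelSpace ((((cmDatum L 2 (Matrix.of fun i j : Fin 2 => if i.val + j.val + 1 = 2 then (1 : L) else 0)).Local v ×
      (cmDatum L 1 (Matrix.of fun i j : Fin 1 => if i.val + j.val + 1 = 1 then (1 : L) else 0)).Local v) ⧸ T) × ↥T) := Prod.borelSpace
  have hD₀ : MeasurableSet {p : (((cmDatum L 2 (Matrix.of fun i j : Fin 2 => if i.val + j.val + 1 = 2 then (1 : L) else 0)).Local v ×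
      (cmDatum L 1 (Matrix.of fun i j : Fin 1 => if i.val + j.val + 1 = 1 then (1 : L) else 0)).Local v) ⧸ T) × ↥T |
        ((p.2 : ↥T) : (cmDatum L 2 (Matrix.of fun i j : Fin 2 => if i.val + j.val + 1 = 2 then (1 : L) else 0)).Local v ×
          (cmDatum L 1 (Matrix.of fun i j : Fin 1 => if i.val + j.val + 1 = 1 then (1 : L) else 0)).Local v) ∈
          {s : (cmDatum L 2 (Matrix.of fun i j : Fin 2 => if i.val + j.val + 1 = 2 then (1 : L) else 0)).Local v ×
            (cmDatum L 1 (Matrix.of fun i j : Fin 1 => if i.val + j.val + 1 = 1 then (1 : L) else 0)).Local v | IsLocalGRegular L v s}} :=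
    measurableSet_regularSet_conjFamily T _ hRm
  have hinj := locallyInjOn_conjFamily T hTc hTa Φ hΦ {s | IsLocalGRegular L v s} hRT hW
  rw [← image_conjFamily_GRegular_eq Φ hΦ, ← Set.univ_inter {p : (((cmDatum L 2 (Matrix.of fun i j : Fin 2 => if i.val + j.val + 1 = 2 then (1 : L) else 0)).Local v ×
      (cmDatum L 1 (Matrix.of fun i j : Fin 1 => if i.val + j.val + 1 = 1 then (1 : L) else 0)).Local v) ⧸ T) × ↥T |
        ((p.2 : ↥T) : (cmDatum L 2 (Matrix.of fun i j : Fin 2 => if i.val + j.val + 1 = 2 then (1 : L) else 0)).Local v ×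
          (cmDatum L 1 (Matrix.of fun i j : Fin 1 => if i.val + j.val + 1 = 1 then (1 : L) else 0)).Local v) ∈
          {s : (cmDatum L 2 (Matrix.of fun i j : Fin 2 => if i.val + j.val + 1 = 2 then (1 : L) else 0)).Local v ×
            (cmDatum L 1 (Matrix.of fun i j : Fin 1 => if i.val + j.val + 1 = 1 then (1 : L) else 0)).Local v | IsLocalGRegular L v s}}]
  exact measurableSet_image_inter_of_locallyInjOn hD₀ hΦc hinj MeasurableSet.univ

/-! ## §2 THE RADIAL WEYL INTEGRATION FORMULA ON `H_T`, by shape over the engine -/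

variable
  (ν : Measure ((cmDatum L 2 (Matrix.of fun i j : Fin 2 => if i.val + j.val + 1 = 2 then (1 : L) else 0)).Local v ×
      (cmDatum L 1 (Matrix.of fun i j : Fin 1 => if i.val + j.val + 1 = 1 then (1 : L) else 0)).Local v)) [ν.IsHaarMeasure] [ν.IsMulRightInvariant]
  (tm : Measure ↥T) [tm.IsMulLeftInvariant] [IsFiniteMeasureOnCompacts tm] [tm.IsOpenPosMeasure] [tm.IsInvInvariant]

include hTc hΦ hTa hRT hRc hW hRm in
/-- **(H3c) «RADIAL-H»: THE WEYL INTEGRATION FORMULA ON THE `T`-REGULAR SET OF A CARTAN SUBGROUP `T = Z_H(γ₀)` OF `H_v = U(Φ₂)(L⁺_v) × U(Φ₁)(L⁺_v)`, RADIAL FORM**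
(by shape over (H3a)(H3b)).  `ν` a Haar measure on `H_v`, `tm` a Haar measure on `T`, `Φ(xT, s) = x s x⁻¹`; «regular» = `G`-REGULAR (`IsLocalGRegular L v`).  There is a measure `σ` on
`T`, finite on compact sets, σ-finite and CARRIED BY `T^{G-reg}`, such that for every Borel `f ≥ 0` on `H_v`
**`[N_H(T) : T] · ∫⁻_{H_T} f dν = ∫⁻_T ∫⁻_{H_v ⧸ T} f(Φ(q, s)) d(ν∕tm)(q) dσ(s)`**, `H_T = {g s g⁻¹ | s ∈ T G-regular}`, `ν∕tm` = ★ `quotientMeasure` — ★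
`exists_radialMeasure_lintegral_conjFamily` with `R := {s | IsLocalGRegular L v s}`.  Classically `dσ = |D|·dtm` (the (H4) socket; NOT asserted). [cite: Rogawski1990, §12.5 pp. 182–183]
[cite: HarishChandra1970, Lemma 42] [cite: Weil1965, n° 49 Lemme 22 (p. 70)] [cite: Federer1969, §2.10.10] -/
theorem exists_radialMeasure_lintegral_cartanSetH :
    ∃ σ : Measure ↥T, IsFiniteMeasureOnCompacts σ ∧ SigmaFinite σ ∧
      σ {t : ↥T | ¬ IsLocalGRegular L v (t : (cmDatum L 2 (Matrix.of fun i j : Fin 2 => if i.val + j.val + 1 = 2 then (1 : L) else 0)).Local v ×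
        (cmDatum L 1 (Matrix.of fun i j : Fin 1 => if i.val + j.val + 1 = 1 then (1 : L) else 0)).Local v)} = 0 ∧
      ∀ f : ((cmDatum L 2 (Matrix.of fun i j : Fin 2 => if i.val + j.val + 1 = 2 then (1 : L) else 0)).Local v ×
          (cmDatum L 1 (Matrix.of fun i j : Fin 1 => if i.val + j.val + 1 = 1 then (1 : L) else 0)).Local v) → ℝ≥0∞, Measurable f →
        ((T.subgroupOf (Subgroup.normalizer (T : Set ((cmDatum L 2 (Matrix.of fun i j : Fin 2 => if i.val + j.val + 1 = 2 then (1 : L) else 0)).Local v ×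
            (cmDatum L 1 (Matrix.of fun i j : Fin 1 => if i.val + j.val + 1 = 1 then (1 : L) else 0)).Local v)))).index : ℝ≥0∞) *
            ∫⁻ y in {x | ∃ g t : (cmDatum L 2 (Matrix.of fun i j : Fin 2 => if i.val + j.val + 1 = 2 then (1 : L) else 0)).Local v ×
                (cmDatum L 1 (Matrix.of fun i j : Fin 1 => if i.val + j.val + 1 = 1 then (1 : L) else 0)).Local v,
              t ∈ T ∧ IsLocalGRegular L v t ∧ g * t * g⁻¹ = x}, f y ∂ν =
          ∫⁻ t, ∫⁻ q, f (Φ (q, t)) ∂(quotientMeasure T tm hTc ν) ∂σ := by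
  classical
  obtain ⟨σ', hfin, hsf, hcar, hmain⟩ := exists_radialMeasure_lintegral_conjFamily T hTc hTa ν Φ hΦ _ hRm hRT hRc hW tm
  refine ⟨σ', hfin, hsf, hcar, fun f hf => ?_⟩
  have h := hmain f hf
  rwa [image_conjFamily_GRegular_eq Φ hΦ] at h

include hTc hΦ hTa hRT hRc hW hRm in
/-- **(H3c) — measure and Bochner forms** (same `σ` as `exists_radialMeasure_lintegral_cartanSetH`): in addition to the `∫⁻` identity,
`(σ ⊗ (ν∕tm)) ∘ Φ̃⁻¹ = [N_H(T):T] · ν|_{H_T}` as measures on `H_v` (`Φ̃(s, q) = Φ(q, s)`), and for every `g : H_v → ℂ` that is `ν`-integrable on `H_T` the integrand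
`(s, q) ↦ g(Φ(q, s))` is `σ ⊗ (ν∕tm)`-integrable with **`∫_T ∫_{H_v ⧸ T} g(Φ(q, s)) d(ν∕tm) dσ = [N_H(T):T] • ∫_{H_T} g dν`** (★ p849733 §2 transport).
[cite: Rogawski1990, §12.5 pp. 182–183] [cite: HarishChandra1970, Lemma 42] [cite: Federer1969, §2.10.10] -/
theorem exists_radialMeasure_integral_cartanSetH :
    ∃ σ : Measure ↥T, IsFiniteMeasureOnCompacts σ ∧ SigmaFinite σ ∧
      σ {t : ↥T | ¬ IsLocalGRegular L v (t : (cmDatum L 2 (Matrix.of fun i j : Fin 2 => if i.val + j.val + 1 = 2 then (1 : L) else 0)).Local v ×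
        (cmDatum L 1 (Matrix.of fun i j : Fin 1 => if i.val + j.val + 1 = 1 then (1 : L) else 0)).Local v)} = 0 ∧
      (∀ f : ((cmDatum L 2 (Matrix.of fun i j : Fin 2 => if i.val + j.val + 1 = 2 then (1 : L) else 0)).Local v ×
          (cmDatum L 1 (Matrix.of fun i j : Fin 1 => if i.val + j.val + 1 = 1 then (1 : L) else 0)).Local v) → ℝ≥0∞, Measurable f →
        ((T.subgroupOf (Subgroup.normalizer (T : Set ((cmDatum L 2 (Matrix.of fun i j : Fin 2 => if i.val + j.val + 1 = 2 then (1 : L) else 0)).Local v ×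
            (cmDatum L 1 (Matrix.of fun i j : Fin 1 => if i.val + j.val + 1 = 1 then (1 : L) else 0)).Local v)))).index : ℝ≥0∞) *
            ∫⁻ y in {x | ∃ g t : (cmDatum L 2 (Matrix.of fun i j : Fin 2 => if i.val + j.val + 1 = 2 then (1 : L) else 0)).Local v ×
                (cmDatum L 1 (Matrix.of fun i j : Fin 1 => if i.val + j.val + 1 = 1 then (1 : L) else 0)).Local v,
              t ∈ T ∧ IsLocalGRegular L v t ∧ g * t * g⁻¹ = x}, f y ∂ν =
          ∫⁻ t, ∫⁻ q, f (Φ (q, t)) ∂(quotientMeasure T tm hTc ν) ∂σ) ∧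
      (σ.prod (quotientMeasure T tm hTc ν)).map (fun p => Φ (p.2, p.1)) =
        ((T.subgroupOf (Subgroup.normalizer (T : Set ((cmDatum L 2 (Matrix.of fun i j : Fin 2 => if i.val + j.val + 1 = 2 then (1 : L) else 0)).Local v ×
            (cmDatum L 1 (Matrix.of fun i j : Fin 1 => if i.val + j.val + 1 = 1 then (1 : L) else 0)).Local v)))).index : ℝ≥0∞) •
          ν.restrict {x | ∃ g t : (cmDatum L 2 (Matrix.of fun i j : Fin 2 => if i.val + j.val + 1 = 2 then (1 : L) else 0)).Local v ×
              (cmDatum L 1 (Matrix.of fun i j : Fin 1 => if i.val + j.val + 1 = 1 then (1 : L) else 0)).Local v,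
            t ∈ T ∧ IsLocalGRegular L v t ∧ g * t * g⁻¹ = x} ∧
      ∀ g : ((cmDatum L 2 (Matrix.of fun i j : Fin 2 => if i.val + j.val + 1 = 2 then (1 : L) else 0)).Local v ×
          (cmDatum L 1 (Matrix.of fun i j : Fin 1 => if i.val + j.val + 1 = 1 then (1 : L) else 0)).Local v) → ℂ,
        IntegrableOn g {x | ∃ g t : (cmDatum L 2 (Matrix.of fun i j : Fin 2 => if i.val + j.val + 1 = 2 then (1 : L) else 0)).Local v ×
            (cmDatum L 1 (Matrix.of fun i j : Fin 1 => if i.val + j.val + 1 = 1 then (1 : L) else 0)).Local v,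
          t ∈ T ∧ IsLocalGRegular L v t ∧ g * t * g⁻¹ = x} ν →
        Integrable (fun p : ↥T × (((cmDatum L 2 (Matrix.of fun i j : Fin 2 => if i.val + j.val + 1 = 2 then (1 : L) else 0)).Local v ×
            (cmDatum L 1 (Matrix.of fun i j : Fin 1 => if i.val + j.val + 1 = 1 then (1 : L) else 0)).Local v) ⧸ T) => g (Φ (p.2, p.1)))
            (σ.prod (quotientMeasure T tm hTc ν)) ∧
          ∫ t, ∫ q, g (Φ (q, t)) ∂(quotientMeasure T tm hTc ν) ∂σ =
            ((T.subgroupOf (Subgroup.normalizer (T : Set ((cmDatum L 2 (Matrix.of fun i j : Fin 2 => if i.val + j.val + 1 = 2 then (1 : L) else 0)).Local v ×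
                (cmDatum L 1 (Matrix.of fun i j : Fin 1 => if i.val + j.val + 1 = 1 then (1 : L) else 0)).Local v)))).index : ℝ) •
              ∫ y in {x | ∃ g t : (cmDatum L 2 (Matrix.of fun i j : Fin 2 => if i.val + j.val + 1 = 2 then (1 : L) else 0)).Local v ×
                  (cmDatum L 1 (Matrix.of fun i j : Fin 1 => if i.val + j.val + 1 = 1 then (1 : L) else 0)).Local v,
                t ∈ T ∧ IsLocalGRegular L v t ∧ g * t * g⁻¹ = x}, g y ∂ν := by
  obtain ⟨σ', hfin, hsf, hcar, hmain⟩ := exists_radialMeasure_lintegral_cartanSetH Φ hΦ hTc hTa hRT hRc hW hRm ν tm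
  haveI := hsf
  haveI : SecondCountableTopology (((cmDatum L 2 (Matrix.of fun i j : Fin 2 => if i.val + j.val + 1 = 2 then (1 : L) else 0)).Local v ×
      (cmDatum L 1 (Matrix.of fun i j : Fin 1 => if i.val + j.val + 1 = 1 then (1 : L) else 0)).Local v) ⧸ T) :=
    (QuotientGroup.isQuotientMap_mk _).secondCountableTopology QuotientGroup.isOpenMap_coe
  haveI : LocallyCompactSpace (((cmDatum L 2 (Matrix.of fun i j : Fin 2 => if i.val + j.val + 1 = 2 then (1 : L) else 0)).Local v ×
      (cmDatum L 1 (Matrix.of fun i j : Fin 1 => if i.val + j.val + 1 = 1 then (1 : L) else 0)).Local v) ⧸ T) := QuotientGroup.instLocallyCompactSpace _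
  haveI : SigmaCompactSpace (((cmDatum L 2 (Matrix.of fun i j : Fin 2 => if i.val + j.val + 1 = 2 then (1 : L) else 0)).Local v ×
      (cmDatum L 1 (Matrix.of fun i j : Fin 1 => if i.val + j.val + 1 = 1 then (1 : L) else 0)).Local v) ⧸ T) := sigmaCompactSpace_of_locallyCompact_secondCountable
  haveI : IsClosed (T : Set ((cmDatum L 2 (Matrix.of fun i j : Fin 2 => if i.val + j.val + 1 = 2 then (1 : L) else 0)).Local v ×
      (cmDatum L 1 (Matrix.of fun i j : Fin 1 => if i.val + j.val + 1 = 1 then (1 : L) else 0)).Local v)) := hTc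
  haveI : SigmaFinite (quotientMeasure T tm hTc ν) := SigmaFinite.of_isFiniteMeasureOnCompacts _
  haveI : SecondCountableTopology ↥T := TopologicalSpace.Subtype.secondCountableTopology _
  haveI : BorelSpace ((((cmDatum L 2 (Matrix.of fun i j : Fin 2 => if i.val + j.val + 1 = 2 then (1 : L) else 0)).Local v ×
      (cmDatum L 1 (Matrix.of fun i j : Fin 1 => if i.val + j.val + 1 = 1 then (1 : L) else 0)).Local v) ⧸ T) × ↥T) := Prod.borelSpace
  have hΦm : Measurable Φ := (continuous_conjFamily_and_smul T Φ hΦ).1.measurable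
  exact ⟨σ', hfin, hsf, hcar, hmain, map_prod_eq_smul_restrict_of_lintegral_radial hΦm hmain,
    fun g hg => integrable_and_integral_eq_smul_of_lintegral_radial hΦm hmain g hg⟩

/-! ## §3 BY NAME at `T = Z_H(γ₀)`: every by-shape binder discharged (★ (H3a) WEYL-FIN-H, ★ (H3b) CARTAN-FIELDS-H, the ★ `H_v` kit) — UNCONDITIONAL -/

include hΦ in
/-- **(H3c) at a genuine Cartan subgroup `T = Z_H(γ₀)`, `γ₀` `G`-regular, non-split `v` — BY NAME.**  The `∫⁻`, measure and ℂ-Bochner forms of the radial Weyl integration formula on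
`H_T`, with the by-shape binders of §2 DISCHARGED: `T` closed (★ (H3b) `isClosed_cartan`), abelian (★ `centralizer_comm_of_isLocalGRegular`), self-centralising at its `G`-regular elements
(★ (H3b) `centralizer_eq_cartan_of_isLocalGRegular`), the `G`-regular locus Borel (★ (H3b) `measurableSet_setOf_isLocalGRegular`) and conjugation-invariant (★ `isLocalGRegular_conj_iff`), Weyl group finite
(★ (H3a) `index_centralizer_subgroupOf_normalizer_ne_zero`) — UNCONDITIONAL: the radial Weyl integration formula on `H_{Z_H(γ₀)}` for every `G`-regular `γ₀ ∈ H_v` at a non-split `v`. [cite: Rogawski1990, §12.5 pp. 182–183] [cite: HarishChandra1970, Lemma 42] [cite: Federer1969, §2.10.10] -/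
theorem exists_radialMeasure_integral_centralizerH
    {γ₀ : (cmDatum L 2 (Matrix.of fun i j : Fin 2 => if i.val + j.val + 1 = 2 then (1 : L) else 0)).Local v ×
      (cmDatum L 1 (Matrix.of fun i j : Fin 1 => if i.val + j.val + 1 = 1 then (1 : L) else 0)).Local v}
    (hγ₀ : IsLocalGRegular L v γ₀)
    (hT : T = Subgroup.centralizer ({γ₀} : Set ((cmDatum L 2 (Matrix.of fun i j : Fin 2 => if i.val + j.val + 1 = 2 then (1 : L) else 0)).Local v ×
      (cmDatum L 1 (Matrix.of fun i j : Fin 1 => if i.val + j.val + 1 = 1 then (1 : L) else 0)).Local v)))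
    (hns : ∀ w : PlacesOver L v, IsCMField.complexConj L • w.1 = w.1) :
    ∃ σ : Measure ↥T, IsFiniteMeasureOnCompacts σ ∧ SigmaFinite σ ∧
      σ {t : ↥T | ¬ IsLocalGRegular L v (t : (cmDatum L 2 (Matrix.of fun i j : Fin 2 => if i.val + j.val + 1 = 2 then (1 : L) else 0)).Local v ×
        (cmDatum L 1 (Matrix.of fun i j : Fin 1 => if i.val + j.val + 1 = 1 then (1 : L) else 0)).Local v)} = 0 ∧
      (∀ f : ((cmDatum L 2 (Matrix.of fun i j : Fin 2 => if i.val + j.val + 1 = 2 then (1 : L) else 0)).Local v ×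
          (cmDatum L 1 (Matrix.of fun i j : Fin 1 => if i.val + j.val + 1 = 1 then (1 : L) else 0)).Local v) → ℝ≥0∞, Measurable f →
        ((T.subgroupOf (Subgroup.normalizer (T : Set ((cmDatum L 2 (Matrix.of fun i j : Fin 2 => if i.val + j.val + 1 = 2 then (1 : L) else 0)).Local v ×
            (cmDatum L 1 (Matrix.of fun i j : Fin 1 => if i.val + j.val + 1 = 1 then (1 : L) else 0)).Local v)))).index : ℝ≥0∞) *
            ∫⁻ y in {x | ∃ g t : (cmDatum L 2 (Matrix.of fun i j : Fin 2 => if i.val + j.val + 1 = 2 then (1 : L) else 0)).Local v ×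
                (cmDatum L 1 (Matrix.of fun i j : Fin 1 => if i.val + j.val + 1 = 1 then (1 : L) else 0)).Local v,
              t ∈ T ∧ IsLocalGRegular L v t ∧ g * t * g⁻¹ = x}, f y ∂ν =
          ∫⁻ t, ∫⁻ q, f (Φ (q, t)) ∂(quotientMeasure T tm (F0P3cStCharTSUpTrCartanFields.isClosed_cartan hT) ν) ∂σ) ∧
      (σ.prod (quotientMeasure T tm (F0P3cStCharTSUpTrCartanFields.isClosed_cartan hT) ν)).map (fun p => Φ (p.2, p.1)) =
        ((T.subgroupOf (Subgroup.normalizer (T : Set ((cmDatum L 2 (Matrix.of fun i j : Fin 2 => if i.val + j.val + 1 = 2 then (1 : L) else 0)).Local v ×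
            (cmDatum L 1 (Matrix.of fun i j : Fin 1 => if i.val + j.val + 1 = 1 then (1 : L) else 0)).Local v)))).index : ℝ≥0∞) •
          ν.restrict {x | ∃ g t : (cmDatum L 2 (Matrix.of fun i j : Fin 2 => if i.val + j.val + 1 = 2 then (1 : L) else 0)).Local v ×
              (cmDatum L 1 (Matrix.of fun i j : Fin 1 => if i.val + j.val + 1 = 1 then (1 : L) else 0)).Local v,
            t ∈ T ∧ IsLocalGRegular L v t ∧ g * t * g⁻¹ = x} ∧
      ∀ g : ((cmDatum L 2 (Matrix.of fun i j : Fin 2 => if i.val + j.val + 1 = 2 then (1 : L) else 0)).Local v ×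
          (cmDatum L 1 (Matrix.of fun i j : Fin 1 => if i.val + j.val + 1 = 1 then (1 : L) else 0)).Local v) → ℂ,
        IntegrableOn g {x | ∃ g t : (cmDatum L 2 (Matrix.of fun i j : Fin 2 => if i.val + j.val + 1 = 2 then (1 : L) else 0)).Local v ×
            (cmDatum L 1 (Matrix.of fun i j : Fin 1 => if i.val + j.val + 1 = 1 then (1 : L) else 0)).Local v,
          t ∈ T ∧ IsLocalGRegular L v t ∧ g * t * g⁻¹ = x} ν →
        Integrable (fun p : ↥T × (((cmDatum L 2 (Matrix.of fun i j : Fin 2 => if i.val + j.val + 1 = 2 then (1 : L) else 0)).Local v ×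
            (cmDatum L 1 (Matrix.of fun i j : Fin 1 => if i.val + j.val + 1 = 1 then (1 : L) else 0)).Local v) ⧸ T) => g (Φ (p.2, p.1)))
            (σ.prod (quotientMeasure T tm (F0P3cStCharTSUpTrCartanFields.isClosed_cartan hT) ν)) ∧
          ∫ t, ∫ q, g (Φ (q, t)) ∂(quotientMeasure T tm (F0P3cStCharTSUpTrCartanFields.isClosed_cartan hT) ν) ∂σ =
            ((T.subgroupOf (Subgroup.normalizer (T : Set ((cmDatum L 2 (Matrix.of fun i j : Fin 2 => if i.val + j.val + 1 = 2 then (1 : L) else 0)).Local v ×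
                (cmDatum L 1 (Matrix.of fun i j : Fin 1 => if i.val + j.val + 1 = 1 then (1 : L) else 0)).Local v)))).index : ℝ) •
              ∫ y in {x | ∃ g t : (cmDatum L 2 (Matrix.of fun i j : Fin 2 => if i.val + j.val + 1 = 2 then (1 : L) else 0)).Local v ×
                  (cmDatum L 1 (Matrix.of fun i j : Fin 1 => if i.val + j.val + 1 = 1 then (1 : L) else 0)).Local v,
                t ∈ T ∧ IsLocalGRegular L v t ∧ g * t * g⁻¹ = x}, g y ∂ν := by
  have hTa' : ∀ a ∈ T, ∀ b ∈ T, a * b = b * a := by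
    subst hT
    exact centralizer_comm_of_isLocalGRegular L v γ₀ hγ₀
  have hRT' : ∀ s : ↥T, IsLocalGRegular L v (s : (cmDatum L 2 (Matrix.of fun i j : Fin 2 => if i.val + j.val + 1 = 2 then (1 : L) else 0)).Local v ×
      (cmDatum L 1 (Matrix.of fun i j : Fin 1 => if i.val + j.val + 1 = 1 then (1 : L) else 0)).Local v) →
      Subgroup.centralizer ({(s : (cmDatum L 2 (Matrix.of fun i j : Fin 2 => if i.val + j.val + 1 = 2 then (1 : L) else 0)).Local v ×
        (cmDatum L 1 (Matrix.of fun i j : Fin 1 => if i.val + j.val + 1 = 1 then (1 : L) else 0)).Local v)} : Set _) = T :=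
    fun s hs => F0P3cStCharTSUpTrCartanFields.centralizer_eq_cartan_of_isLocalGRegular hγ₀ hT s hs
  have hRc' : ∀ g x : (cmDatum L 2 (Matrix.of fun i j : Fin 2 => if i.val + j.val + 1 = 2 then (1 : L) else 0)).Local v ×
      (cmDatum L 1 (Matrix.of fun i j : Fin 1 => if i.val + j.val + 1 = 1 then (1 : L) else 0)).Local v,
      IsLocalGRegular L v x → IsLocalGRegular L v (g * x * g⁻¹) := fun g x hx => (isLocalGRegular_conj_iff L g x).2 hx
  have hRm' := F0P3cStCharTSUpTrCartanFields.measurableSet_setOf_isLocalGRegular L v hns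
  have hW' : (T.subgroupOf (Subgroup.normalizer (T : Set ((cmDatum L 2 (Matrix.of fun i j : Fin 2 => if i.val + j.val + 1 = 2 then (1 : L) else 0)).Local v ×
      (cmDatum L 1 (Matrix.of fun i j : Fin 1 => if i.val + j.val + 1 = 1 then (1 : L) else 0)).Local v)))).index ≠ 0 := by
    rw [hT]
    exact F0P3cStCharTSUpTrWeylFinH.index_centralizer_subgroupOf_normalizer_ne_zero L v hns γ₀ hγ₀
  exact exists_radialMeasure_integral_cartanSetH Φ hΦ (F0P3cStCharTSUpTrCartanFields.isClosed_cartan hT) hTa' hRT' hRc' hW' hRm' ν tm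

end Cartan

end Summit.HodgeConjecture.HodgeConjecture.Cruxes.H413.F0P3cStCharTSUpTrRadial

end
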